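/-
Copyright (c) 2026 the pub-hodgecm-mathlib formalisation cell (harness21).  Prover seat hodgecm-mathlib-F0P3a-p01 (g37), FLOOR 0, SUPPORTS-ONLY on h413; β-BOARD v1 R10
(assembler ∕ chair): `hRest` OF RECORD MODULO THE FOUR OWED LATTICE SCHEMAS (κ-class of tower 1, equilateral window, boundary H row, below-boundary H zero — all at ONE placement).  2026-09-04.
-/
import Summits.HodgeConjecture.HodgeConjecture.Theorems.F0P3cDyRamOddLabelledRestOfRows          -- ★ p861938 (this seat): `restSum_eq_restTarget_of_rows`
import Summits.HodgeConjecture.HodgeConjecture.Theorems.F0P3cDyRamOddLabelledHangingLine         -- ★ p861984 + ED. 2 (LH4-p05 (g9)): `hangingValue_of_rows`, `equilateral_zero_of_window`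
import Summits.HodgeConjecture.HodgeConjecture.Theorems.F0P3cDyRamLabelledOddGlueWindow          -- ★ p861953 (LH7-p05 (g0)): R7-C `…_of_foot_window`
import Summits.HodgeConjecture.HodgeConjecture.Theorems.F0P3cDyRamOddLabelledKappaLines          -- ★ (LH4-p07 (g10)): `kappaLine_G1_of_rows`
import Summits.HodgeConjecture.HodgeConjecture.Theorems.F0P3cDyRamOddLabelledRestRowsG2OfSwap    -- ★ p862074 (this seat): `window_G2_of_G1`, `kappaLine_G2_of_G1`
import Summits.HodgeConjecture.HodgeConjecture.Theorems.F0P3cDyRamOddLabelledRestRowsG3OfSwap    -- ★ p862171 (this seat): `kappaLine_G3_of_G1`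
import Summits.HodgeConjecture.HodgeConjecture.Theorems.F0P3cDyRamOddLabelledFootLines           -- ★ p862114 (this seat): `footLine_G3`
import Summits.HodgeConjecture.HodgeConjecture.Theorems.F0P3cDyRamOddLabelledHangingTwins        -- ★ p862207 (this seat): `boundary₁_of_boundary₃`, `boundary₂_of_boundary₁`, `zero₁_of_zero₃`, `zero₂_of_zero₁`
import HarnessLib

/-!
# Crux `H413`, LH4 «(D-RAM) FOUR-FRAME» road, STAGE 1b (β) — `hRest` OF RECORD MODULO THE FOUR OWED LATTICE SCHEMAS

Cell `hodgecm-mathlib` (D-0151), FLOOR 0, crux item H413 = `stmt-HodgeConjecture-24833`, route `HCCMUnconditional`; squad F0∕P3c∕LH4.  THEOREMS ONLY (no `def`, no instance, no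
notation, no `sorry`, default heartbeats); ★-only imports; lane `--supports stmt-HodgeConjecture-24833 --as helper` (count-neutral; pays NO row by itself).

WHAT THIS FILE DOES (chair's LEDGER #19).  The fourth binder `hRest` of the (T2) trunk ★ p861403 — the rest shapes total `restTarget` at every derived-record datum and slot —
is assembled from everything that is ★: ★ p861938 `restSum_eq_restTarget_of_rows` over `hH` := LH4-p05 (g9)'s ★ `hangingValue_of_rows` (+ `equilateral_zero_of_window`, with
LH7-p05's ★ p862023 inside), `hC₁` := LH7-p05's ★ p861953 window, `hR6₁` := LH4-p07 (g10)'s ★ `kappaLine_G1_of_rows`, `hC₂`∕`hR6₂` := ★ p862074 (swap), `hF₃` := ★ p862114,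
`hR6₃` := ★ p862171 (LH7-p07's `(0 2)∘α⁻¹` engine), and the hanging-line twins ★ p862207.  What is NOT ★ enters as FOUR HYPOTHESES, each a ∀-closed LATTICE SCHEMA at ONE
placement, in the letters its typist announced: `hK` — the tower-1 κ-CLASS value on the κ-branch (LH4-p07's `hκ` binder; LH4-p11 (g9) R6a); `hW` — the EQUILATERAL WINDOW zero of
the core-hanging stratum (LH4-p05's `hEqW` binder; LH7-p05 (g0) EQ-2 ∕ LH7-p08 (g0) EQ-a); `hB` — the BOUNDARY H row at the placement `n₁ = n₂`, `n₃ + 2 = n₁ + 2d` (LH4-p05's `hB₃`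
binder; LH7-p08 FILE 4c); `hZ` — the BELOW-BOUNDARY H zero at the placement `n₁ = n₂ < n₃`, `n₃ + 4 ≤ n₁ + 2d` (LH4-p05's `hZ₃` binder; LH7-p08).  Conclusion: the trunk's `hRest`
binder type VERBATIM.  Hence the PAY LINE of the tier-0 stub is `…StageBBoxForm.…_of_box (hbox_of_oddBoxSum oddLabelledBoxSum hP3G1_ofRecord hP3G2_ofRecord hP2G3_ofRecord
(hRest_of_heads hK hW hB hZ))` — four lattice heads away (kernel-checked by paste with `sorry` stand-ins for the four, HOME `PAY-HARNESS`).
HONEST LABEL.  Count-neutral junction; the four schemas are hypotheses; (β), T₊ OPEN; `HC_CM` is proved only modulo the 7 printed citations (2 remaining named inputs: hLiu418 =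
`stmt-HodgeConjecture-24832`, h413 = `stmt-HodgeConjecture-24833`) until rung 0 closes.

## References
* [Kottwitz1986BaseChangeUnits] R. E. Kottwitz, *Base change for unit elements of Hecke algebras*, Compositio Math. 60 (1986), §1 pp. 240–241 (lattice counts by strata).
* [Rogawski1990] J. D. Rogawski, *Automorphic Representations of Unitary Groups in Three Variables*, Ann. of Math. Stud. 123 (1990), §4.9 Prop. 4.9.1 (a)(b) p. 55.
-/

set_option autoImplicit false

noncomputable section

namespace Summit.HodgeConjecture.HodgeConjecture.Cruxes.H413.F0P3cDyRamOddLabelledRestOfHeads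

open Literature.NumberTheory.Automorphic Literature.NumberTheory.Automorphic.HermitianLattice Literature.NumberTheory.Automorphic.UnitaryGroup
open Literature.NumberTheory.Automorphic.UnitaryLatticeTree Literature.NumberTheory.Automorphic.UnitaryThreeFourFrame
open Summit.HodgeConjecture.HodgeConjecture.Cruxes.H413.F0P3cDyRamFourFramePieces
open Summit.HodgeConjecture.HodgeConjecture.Cruxes.H413.F0P3cDyRamFourFrameCensusDefs
open Summit.HodgeConjecture.HodgeConjecture.Cruxes.H413.F0P3cDyRamStageOneBDefs (mcOfRecord)
open Summit.HodgeConjecture.HodgeConjecture.Cruxes.H413.F0P3cDyRamStageOneBDerivedDefs (n0DerivedOfRecord mcOfRecord_le_n0DerivedOfRecord)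
open Summit.HodgeConjecture.HodgeConjecture.Cruxes.H413.F0P3cDyRamDiagonalTorusDefs
open Summit.HodgeConjecture.HodgeConjecture.Cruxes.H413.F0P3cDyRamDiagonalStrataDefs
open Summit.HodgeConjecture.HodgeConjecture.Cruxes.H413.F0P3cDyRamLabelledOddCountDefs
open Summit.HodgeConjecture.HodgeConjecture.Cruxes.H413.F0P3cDyRamOddLabelledBoxSumDefs (IsRestShape restTarget)
open Summit.HodgeConjecture.HodgeConjecture.Cruxes.H413.F0P3cDyRamOddLabelledRestOfRows (restSum_eq_restTarget_of_rows)
open Summit.HodgeConjecture.HodgeConjecture.Cruxes.H413.F0P3cDyRamOddLabelledHangingLine (hangingValue_of_rows equilateral_zero_of_window)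
open Summit.HodgeConjecture.HodgeConjecture.Cruxes.H413.F0P3cDyRamLabelledOddGlueWindow (finsum_stratum_G1_shell_labelledOdd_div_relIndex_eq_zero_of_foot_window)
open Summit.HodgeConjecture.HodgeConjecture.Cruxes.H413.F0P3cDyRamOddLabelledKappaLines (kappaLine_G1_of_rows)
open Summit.HodgeConjecture.HodgeConjecture.Cruxes.H413.F0P3cDyRamOddLabelledRestRowsG2OfSwap (window_G2_of_G1 kappaLine_G2_of_G1)
open Summit.HodgeConjecture.HodgeConjecture.Cruxes.H413.F0P3cDyRamOddLabelledRestRowsG3OfSwap (kappaLine_G3_of_G1)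
open Summit.HodgeConjecture.HodgeConjecture.Cruxes.H413.F0P3cDyRamOddLabelledFootLines (footLine_G3)
open Summit.HodgeConjecture.HodgeConjecture.Cruxes.H413.F0P3cDyRamOddLabelledHangingTwins (boundary₁_of_boundary₃ boundary₂_of_boundary₁ zero₁_of_zero₃ zero₂_of_zero₁)
open Summit.HodgeConjecture.HodgeConjecture.Cruxes.H413.F0P3cDyRamLabelledOddStageBTable (three_mul_sub_two_add_mod_le_n0DerivedOfRecord)
open Summit.HodgeConjecture.HodgeConjecture.Cruxes.H413.F0P3cDyRamDiagonalKappaCoreHangingClass (two_le_d_of_v_two_lt_one)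
open scoped Valued WithZero Matrix MatrixGroups

/-- **`hRest` OF RECORD, MODULO THE FOUR OWED LATTICE SCHEMAS.**  Given (∀-closed over the field, the derived-record datum, the torus element and the tokens): `hK` — the tower-1
κ-class value on the κ-branch `2ρ + ℓ₀ = n₂`, `2ρ + s + ℓ₀ < n₁`: `v_i(G₁(ρ,s)) = (ω_A, 0, 0)_i ∕ 2 · q^(2ρ−1+s∕2) · F(n₁)`; `hW` — on the equilateral key the clean-shell table of
`H(ρ)` vanishes in the window `n₂ ≤ 2ρ + ℓ₀`, `2ρ + mc ≤ 2n₂`; `hB` — the boundary H row at `n₁ = n₂`, `n₃ + 2 = n₁ + 2d`, `2ρ + ℓ₀ = n₁`: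
`(0, 0, −(ω(−1)ω_B + ω(−1)ω_A))_i ∕ 2 · q^(2ρ−1)`; `hZ` — the H zero at `n₁ = n₂ < n₃`, `n₃ + 4 ≤ n₁ + 2d`, `2ρ + ℓ₀ = n₁` — THEN the (T2) trunk's `hRest` holds: at every
derived-record datum and slot, `Σ_a [IsRestShape] · v_i(a) = restTarget q d n₁ n₂ n₃ ω_A ω_B ω_C ω(−1) i`.  Everything else is ★ and plugged by name (see the module doc).
[cite: Kottwitz1986BaseChangeUnits, §1 pp. 240–241] [cite: Rogawski1990, §4.9 Prop. 4.9.1 (a)(b) p. 55] -/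
theorem hRest_of_heads
    (hK : ∀ {K : Type} [Field K] [Valued K ℤᵐ⁰] [CompleteSpace K] [Fintype 𝓀[K]] (σ : K →+* K) (ϖ : K) (d t : ℕ),
      Valued.v (2 : K) < 1 → IsRamifiedQuadraticDatum σ ϖ d t →
      ∀ (α β : K) (n₁ n₂ n₃ : ℕ), IsElementDatum σ ϖ (n0DerivedOfRecord d) α β n₁ n₂ n₃ →
      ∀ (T : GL (Fin 3) K), (T : Matrix (Fin 3) (Fin 3) K) = Matrix.diagonal ![α, β, 1] →
      ∀ {eA : K}, σ eA = eA → Valued.v eA = 1 → Valued.v ((ϖ ^ mstarOfRecord d)⁻¹ * ((α - 1) * ((ϖ * σ ϖ) ^ ((n₂ - d % 2) / 2))⁻¹ - eA * ((ϖ - σ ϖ) * ((ϖ * σ ϖ) ^ ((d - d % 2) / 2))⁻¹))) ≤ 1 →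
      ∀ (ρ s : ℕ), 1 ≤ ρ → 1 ≤ s → 2 ∣ s → 2 * ρ + d % 2 = n₂ → 2 * ρ + s + d % 2 < n₁ → ∀ i : Fin 3,
      ∑ᶠ M ∈ {M : Submodule 𝒪[K] (Fin 3 → K) | M ∈ stratum σ ϖ T ![2 * ρ, 2 * ρ + s, 2 * ρ + s] ∧
          (LatticeInLevel ϖ (d % 2) (Matrix.diagonal ![α - 1, β - 1, 0]) M ∧ ¬ LatticeInLevel ϖ (d % 2 + 1) (Matrix.diagonal ![α - 1, β - 1, 0]) M ∧
            LatticeInLevel ϖ (mcOfRecord d) (Matrix.diagonal ![(α - 1) * (α - 1), (β - 1) * (β - 1), 0]) M)},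
        (labelledOddCount σ ϖ 0 i (valueClassLabel σ ϖ (α - 1) (β - 1) (mstarOfRecord d) d) M : ℚ) /
          ((((unitStabilizer M).map (unitNormMap σ 3)).relIndex (fixedUnitTorus σ 3) : ℕ) : ℚ) =
        ((![normSign σ eA, 0, 0] : Fin 3 → ℤ) i : ℚ) / 2 * (Fintype.card 𝓀[K] : ℚ) ^ (2 * ρ - 1 + s / 2) *
          ((if 2 * d + d % 2 + 2 * ρ + s ≤ n₁ then (Fintype.card 𝓀[K] : ℚ) - 1 else 0) - (if n₁ + 2 = 2 * d + d % 2 + 2 * ρ + s then 1 else 0)))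
    (hW : ∀ {K : Type} [Field K] [Valued K ℤᵐ⁰] [CompleteSpace K] [Fintype 𝓀[K]] (σ : K →+* K) (ϖ : K) (d t : ℕ),
      Valued.v (2 : K) < 1 → IsRamifiedQuadraticDatum σ ϖ d t →
      ∀ (α β : K) (n₁ n₂ n₃ : ℕ), IsElementDatum σ ϖ (n0DerivedOfRecord d) α β n₁ n₂ n₃ →
      ∀ (T : GL (Fin 3) K), (T : Matrix (Fin 3) (Fin 3) K) = Matrix.diagonal ![α, β, 1] →
      n₁ = n₂ → n₂ = n₃ → ∀ ρ : ℕ, 1 ≤ ρ → n₂ ≤ 2 * ρ + d % 2 → 2 * ρ + mcOfRecord d ≤ 2 * n₂ → ∀ i : Fin 3,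
      ∑ᶠ M ∈ {M : Submodule 𝒪[K] (Fin 3 → K) | M ∈ stratum σ ϖ T ![2 * ρ, 2 * ρ, 2 * ρ] ∧
          (LatticeInLevel ϖ (d % 2) (Matrix.diagonal ![α - 1, β - 1, 0]) M ∧ ¬ LatticeInLevel ϖ (d % 2 + 1) (Matrix.diagonal ![α - 1, β - 1, 0]) M ∧
            LatticeInLevel ϖ (mcOfRecord d) (Matrix.diagonal ![(α - 1) * (α - 1), (β - 1) * (β - 1), 0]) M)},
        (labelledOddCount σ ϖ 0 i (valueClassLabel σ ϖ (α - 1) (β - 1) (mstarOfRecord d) d) M : ℚ) /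
          ((((unitStabilizer M).map (unitNormMap σ 3)).relIndex (fixedUnitTorus σ 3) : ℕ) : ℚ) = 0)
    (hB : ∀ {K : Type} [Field K] [Valued K ℤᵐ⁰] [CompleteSpace K] [Fintype 𝓀[K]] (σ : K →+* K) (ϖ : K) (d t : ℕ),
      Valued.v (2 : K) < 1 → IsRamifiedQuadraticDatum σ ϖ d t →
      ∀ (α β : K) (n₁ n₂ n₃ : ℕ), IsElementDatum σ ϖ (n0DerivedOfRecord d) α β n₁ n₂ n₃ →
      ∀ (T : GL (Fin 3) K), (T : Matrix (Fin 3) (Fin 3) K) = Matrix.diagonal ![α, β, 1] →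
      ∀ {eA eB : K}, σ eA = eA → Valued.v eA = 1 → Valued.v ((ϖ ^ mstarOfRecord d)⁻¹ * ((α - 1) * ((ϖ * σ ϖ) ^ ((n₂ - d % 2) / 2))⁻¹ - eA * ((ϖ - σ ϖ) * ((ϖ * σ ϖ) ^ ((d - d % 2) / 2))⁻¹))) ≤ 1 →
        σ eB = eB → Valued.v eB = 1 → Valued.v ((ϖ ^ mstarOfRecord d)⁻¹ * ((β - 1) * ((ϖ * σ ϖ) ^ ((n₁ - d % 2) / 2))⁻¹ - eB * ((ϖ - σ ϖ) * ((ϖ * σ ϖ) ^ ((d - d % 2) / 2))⁻¹))) ≤ 1 →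
      n₁ = n₂ → n₃ + 2 = n₁ + 2 * d → ∀ ρ : ℕ, 1 ≤ ρ → 2 * ρ + d % 2 = n₁ → ∀ i : Fin 3,
      ∑ᶠ M ∈ {M : Submodule 𝒪[K] (Fin 3 → K) | M ∈ stratum σ ϖ T ![2 * ρ, 2 * ρ, 2 * ρ] ∧
          (LatticeInLevel ϖ (d % 2) (Matrix.diagonal ![α - 1, β - 1, 0]) M ∧ ¬ LatticeInLevel ϖ (d % 2 + 1) (Matrix.diagonal ![α - 1, β - 1, 0]) M ∧
            LatticeInLevel ϖ (mcOfRecord d) (Matrix.diagonal ![(α - 1) * (α - 1), (β - 1) * (β - 1), 0]) M)},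
        (labelledOddCount σ ϖ 0 i (valueClassLabel σ ϖ (α - 1) (β - 1) (mstarOfRecord d) d) M : ℚ) /
          ((((unitStabilizer M).map (unitNormMap σ 3)).relIndex (fixedUnitTorus σ 3) : ℕ) : ℚ) =
        (((![0, 0, -(normSign σ (-1 : K) * normSign σ eB + normSign σ (-1 : K) * normSign σ eA)] : Fin 3 → ℤ) i : ℤ) : ℚ) / 2 * (Nat.card 𝓀[K] : ℚ) ^ (2 * ρ - 1))
    (hZ : ∀ {K : Type} [Field K] [Valued K ℤᵐ⁰] [CompleteSpace K] [Fintype 𝓀[K]] (σ : K →+* K) (ϖ : K) (d t : ℕ),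
      Valued.v (2 : K) < 1 → IsRamifiedQuadraticDatum σ ϖ d t →
      ∀ (α β : K) (n₁ n₂ n₃ : ℕ), IsElementDatum σ ϖ (n0DerivedOfRecord d) α β n₁ n₂ n₃ →
      ∀ (T : GL (Fin 3) K), (T : Matrix (Fin 3) (Fin 3) K) = Matrix.diagonal ![α, β, 1] →
      n₁ = n₂ → n₁ < n₃ → n₃ + 4 ≤ n₁ + 2 * d → ∀ ρ : ℕ, 1 ≤ ρ → 2 * ρ + d % 2 = n₁ → ∀ i : Fin 3,
      ∑ᶠ M ∈ {M : Submodule 𝒪[K] (Fin 3 → K) | M ∈ stratum σ ϖ T ![2 * ρ, 2 * ρ, 2 * ρ] ∧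
          (LatticeInLevel ϖ (d % 2) (Matrix.diagonal ![α - 1, β - 1, 0]) M ∧ ¬ LatticeInLevel ϖ (d % 2 + 1) (Matrix.diagonal ![α - 1, β - 1, 0]) M ∧
            LatticeInLevel ϖ (mcOfRecord d) (Matrix.diagonal ![(α - 1) * (α - 1), (β - 1) * (β - 1), 0]) M)},
        (labelledOddCount σ ϖ 0 i (valueClassLabel σ ϖ (α - 1) (β - 1) (mstarOfRecord d) d) M : ℚ) /
          ((((unitStabilizer M).map (unitNormMap σ 3)).relIndex (fixedUnitTorus σ 3) : ℕ) : ℚ) = 0) :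
    (∀ {K : Type} [Field K] [Valued K ℤᵐ⁰] [CompleteSpace K] [Fintype 𝓀[K]] (σ : K →+* K) (ϖ : K) (d t : ℕ),
      Valued.v (2 : K) < 1 → IsRamifiedQuadraticDatum σ ϖ d t →
      ∀ (α β : K) (n₁ n₂ n₃ : ℕ), IsElementDatum σ ϖ (n0DerivedOfRecord d) α β n₁ n₂ n₃ →
      ∀ (T : GL (Fin 3) K), (T : Matrix (Fin 3) (Fin 3) K) = Matrix.diagonal ![α, β, 1] →
      ∀ {eA eB eC : K}, σ eA = eA → Valued.v eA = 1 → Valued.v ((ϖ ^ mstarOfRecord d)⁻¹ * ((α - 1) * ((ϖ * σ ϖ) ^ ((n₂ - d % 2) / 2))⁻¹ - eA * ((ϖ - σ ϖ) * ((ϖ * σ ϖ) ^ ((d - d % 2) / 2))⁻¹))) ≤ 1 →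
        σ eB = eB → Valued.v eB = 1 → Valued.v ((ϖ ^ mstarOfRecord d)⁻¹ * ((β - 1) * ((ϖ * σ ϖ) ^ ((n₁ - d % 2) / 2))⁻¹ - eB * ((ϖ - σ ϖ) * ((ϖ * σ ϖ) ^ ((d - d % 2) / 2))⁻¹))) ≤ 1 →
        σ eC = eC → Valued.v eC = 1 → Valued.v ((ϖ ^ mstarOfRecord d)⁻¹ * ((β - α) * ((ϖ * σ ϖ) ^ ((n₃ - d % 2) / 2))⁻¹ - eC * ((ϖ - σ ϖ) * ((ϖ * σ ϖ) ^ ((d - d % 2) / 2))⁻¹))) ≤ 1 →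
      ∀ i : Fin 3,
        (∑ a : Fin 3 → Fin (n₁ + n₂ + n₃ + 1),
          (if IsRestShape d n₁ n₂ n₃ (fun j => (a j : ℕ)) then
            ∑ᶠ M ∈ {M : Submodule 𝒪[K] (Fin 3 → K) | M ∈ stratum σ ϖ T (fun j => (a j : ℕ)) ∧
            (LatticeInLevel ϖ (d % 2) (Matrix.diagonal ![α - 1, β - 1, 0]) M ∧ ¬ LatticeInLevel ϖ (d % 2 + 1) (Matrix.diagonal ![α - 1, β - 1, 0]) M ∧
              LatticeInLevel ϖ (mcOfRecord d) (Matrix.diagonal ![(α - 1) * (α - 1), (β - 1) * (β - 1), 0]) M)},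
          (labelledOddCount σ ϖ 0 i (valueClassLabel σ ϖ (α - 1) (β - 1) (mstarOfRecord d) d) M : ℚ) /
            ((((unitStabilizer M).map (unitNormMap σ 3)).relIndex (fixedUnitTorus σ 3) : ℕ) : ℚ)
           else 0)) =
          restTarget (Fintype.card 𝓀[K]) d n₁ n₂ n₃ (normSign σ eA) (normSign σ eB) (normSign σ eC) (normSign σ (-1 : K)) i) := by
  intro K _ _ _ _ σ ϖ d t h2 hD α β n₁ n₂ n₃ hE T hT eA eB eC hσeA heA1 heA hσeB heB1 heB hσeC heC1 heC i
  have h2d : 2 ≤ d := two_le_d_of_v_two_lt_one hD h2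
  have hmc : mcOfRecord d ≤ n0DerivedOfRecord d := mcOfRecord_le_n0DerivedOfRecord d
  have hreg0 := three_mul_sub_two_add_mod_le_n0DerivedOfRecord d
  have hdN₀ : d ≤ n0DerivedOfRecord d := le_trans (by omega) hreg0
  -- the H line: equilateral window ★ ED. 2, boundary∕zero at `n₁ = n₂` from `hB`∕`hZ`, the other two placements by the ★ twins
  have hEq := equilateral_zero_of_window hD hE hmc T (hW σ ϖ d t h2 hD α β n₁ n₂ n₃ hE T hT)
  have hB₃ := hB σ ϖ d t h2 hD α β n₁ n₂ n₃ hE T hT hσeA heA1 heA hσeB heB1 heB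
  have hB₁ := boundary₁_of_boundary₃ h2 hD
    (fun T' eA' eB' hE' hT' hσA hA1 hA hσB hB1 hB' => hB σ ϖ d t h2 hD _ _ _ _ _ hE' T' hT' hσA hA1 hA hσB hB1 hB') hE T hT hσeA heA1 heA hσeC heC1 heC
  have hB₂ := boundary₂_of_boundary₁ hD
    (fun T' eA' eC' hE' hT' hσA hA1 hA hσC hC1 hC => boundary₁_of_boundary₃ h2 hD
      (fun T'' eA'' eB'' hE'' hT'' hσA' hA1' hA' hσB' hB1' hB'' => hB σ ϖ d t h2 hD _ _ _ _ _ hE'' T'' hT'' hσA' hA1' hA' hσB' hB1' hB'')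
      hE' T' hT' hσA hA1 hA hσC hC1 hC) hE T hT hσeB heB1 heB hσeC heC1 heC
  have hZ₃ := hZ σ ϖ d t h2 hD α β n₁ n₂ n₃ hE T hT
  have hZ₁ := zero₁_of_zero₃ h2 hD (fun T' hE' hT' => hZ σ ϖ d t h2 hD _ _ _ _ _ hE' T' hT') hE T hT
  have hZ₂ := zero₂_of_zero₁ (fun T' hE' hT' => zero₁_of_zero₃ h2 hD (fun T'' hE'' hT'' => hZ σ ϖ d t h2 hD _ _ _ _ _ hE'' T'' hT'') hE' T' hT') hE T hT
  -- the tower-1 κ line at every datum (★ LH4-p07 junction over the κ-class schema `hK`)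
  have hK1 : ∀ {α' β' : K} {n₁' n₂' n₃' : ℕ} (T' : GL (Fin 3) K) (eA' eC' : K), IsElementDatum σ ϖ (n0DerivedOfRecord d) α' β' n₁' n₂' n₃' →
      (T' : Matrix (Fin 3) (Fin 3) K) = Matrix.diagonal ![α', β', 1] →
      σ eA' = eA' → Valued.v eA' = 1 → Valued.v ((ϖ ^ mstarOfRecord d)⁻¹ * ((α' - 1) * ((ϖ * σ ϖ) ^ ((n₂' - d % 2) / 2))⁻¹ - eA' * ((ϖ - σ ϖ) * ((ϖ * σ ϖ) ^ ((d - d % 2) / 2))⁻¹))) ≤ 1 →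
      σ eC' = eC' → Valued.v eC' = 1 → Valued.v ((ϖ ^ mstarOfRecord d)⁻¹ * ((β' - α') * ((ϖ * σ ϖ) ^ ((n₃' - d % 2) / 2))⁻¹ - eC' * ((ϖ - σ ϖ) * ((ϖ * σ ϖ) ^ ((d - d % 2) / 2))⁻¹))) ≤ 1 →
      ∀ (ρ s : ℕ), 1 ≤ ρ → 1 ≤ s → 2 ∣ s → 2 * ρ + d % 2 = n₂' → n₁' ≠ n₂' + s → ∀ i : Fin 3,
        ∑ᶠ M ∈ {M : Submodule 𝒪[K] (Fin 3 → K) | M ∈ stratum σ ϖ T' ![2 * ρ, 2 * ρ + s, 2 * ρ + s] ∧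
              (LatticeInLevel ϖ (d % 2) (Matrix.diagonal ![α' - 1, β' - 1, 0]) M ∧ ¬ LatticeInLevel ϖ (d % 2 + 1) (Matrix.diagonal ![α' - 1, β' - 1, 0]) M ∧
                LatticeInLevel ϖ (mcOfRecord d) (Matrix.diagonal ![(α' - 1) * (α' - 1), (β' - 1) * (β' - 1), 0]) M)},
            (labelledOddCount σ ϖ 0 i (valueClassLabel σ ϖ (α' - 1) (β' - 1) (mstarOfRecord d) d) M : ℚ) /
              ((((unitStabilizer M).map (unitNormMap σ 3)).relIndex (fixedUnitTorus σ 3) : ℕ) : ℚ) =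
        (![(normSign σ eA' : ℚ) + (normSign σ (-1 : K) : ℚ) * (normSign σ eC' : ℚ), 0, 0] : Fin 3 → ℚ) i / 4 * (Fintype.card 𝓀[K] : ℚ) ^ (2 * ρ - 1 + s / 2) *
          ((if 2 * d + d % 2 + 2 * ρ + s ≤ n₁' then (Fintype.card 𝓀[K] : ℚ) - 1 else 0) - (if n₁' + 2 = 2 * d + d % 2 + 2 * ρ + s then 1 else 0)) :=
    fun T' eA' eC' hE' hT' hσA hA1 hA hσC _ hC =>
      kappaLine_G1_of_rows hD hE' hdN₀ T' hT' hσA hA1 hσC hA hC (hK σ ϖ d t h2 hD _ _ _ _ _ hE' T' hT' hσA hA1 hA)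
  exact restSum_eq_restTarget_of_rows h2 hD hE T hT eA eB eC i
    (fun ρ hρ hB' => hangingValue_of_rows h2 hD hE hmc hdN₀ T hT hσeA heA1 heA hσeB heB1 heB hσeC heC1 heC hEq hB₃ hB₂ hB₁ hZ₃ hZ₂ hZ₁ i ρ hρ hB')
    (finsum_stratum_G1_shell_labelledOdd_div_relIndex_eq_zero_of_foot_window hD h2 h2d hE hdN₀ hmc T hT)
    (hK1 T eA eC hE hT hσeA heA1 heA hσeC heC1 heC)
    (window_G2_of_G1 (fun T' hE' hT' => finsum_stratum_G1_shell_labelledOdd_div_relIndex_eq_zero_of_foot_window hD h2 h2d hE' hdN₀ hmc T' hT') hE T hT)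
    (kappaLine_G2_of_G1 hD hK1 hE T hT hσeB heB1 heB hσeC heC1 heC)
    (footLine_G3 h2 hD hE T hT)
    (kappaLine_G3_of_G1 hD hK1 hE T hT hσeA heA1 heA hσeB heB1 heB)

end Summit.HodgeConjecture.HodgeConjecture.Cruxes.H413.F0P3cDyRamOddLabelledRestOfHeads

end
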